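import Summits.Ventures.PercRepro.RankLevelSetIndepSRI
import Summits.Ventures.PercRepro.RankLevelSetIndepCDSum

/-! # RankLevelSetIndepSRISum — (CD) OF THE SUMMANDS GIVES THE CROSS (SRI) OF A DIRECT SUM (night-1 g27; dossier §39.5, §39.13)

For disjoint finite matroids `M, N`, `y ∈ E_M` and `e ∈ E_N`, the four `(y, e)`-slices of the independence polynomial of
`M ⊕ N` are the convolutions of the contraction/deletion profiles of `M` at `y` and of `N` at `e`:
`I_p^∅ = Σ_a y_a(M;y) · y_{p−a}(N;e)`, `I_p^y = Σ_a x_a(M;y) · y_{p−a}(N;e)`, `I_p^e = Σ_a y_a(M;y) · x_{p−a}(N;e)`,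
`I_p^{ye} = Σ_a x_a(M;y) · x_{p−a}(N;e)` (`sliceCount_disjointSum_*`, fibrewise by the two traces). The slice-Rayleigh
inequality `I_p^∅ · I_p^{ye} ≤ I_p^y · I_p^e` is then the 2-row Cauchy–Binet `tp2_conv` of `RankLevelSetBiIndepLRSum`
applied to the TP2 array `[x(M); y(M)]` (the all-pairs (CD) of `M`, `indepCD_all_pairs`) and the TP2 two-row kernel
`(x_{p−i}(N), y_{p−i}(N))` (the all-pairs (CD) of `N`): **`indepSRI_cross_disjointSum : IndepCD M → IndepCD N →
I_p^∅ · I_p^{ye} ≤ I_p^y · I_p^e` for `M ⊕ N` at `y ∈ E_M`, `e ∈ E_N`** — the first theorem relating the two new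
conjectures on the independence complex: (CD) for both summands gives (SRI) across a direct sum (so, with (SRI) within
the summands, the whole (SRI) of the sum). Every declaration has a docstring; imports: the cell's own modules and Mathlib
only. Axioms: standard. -/

namespace PercRepro

open Set Matroid Finset

variable {α : Type} (M N : Matroid α) [M.Finite] [N.Finite]

/-- **The two-trace convolution**: for `y ∈ E_M`, `e ∈ E_N` and predicates `Q` on the `M`-trace, `Q'` on the `N`-trace,
`#{T ⊆ (E_M ∪ E_N) ∖ {y, e} : #T = p, Q (T ∩ E_M), Q' (T ∩ E_N)} = Σ_{a ≤ p} #{T₁ ⊆ E_M ∖ {y} : #T₁ = a, Q T₁} ·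
#{T₂ ⊆ E_N ∖ {e} : #T₂ = p − a, Q' T₂}`. -/
theorem ncard_trace_disjointSum₂ (h : Disjoint M.E N.E) (Q Q' : Set α → Prop) {y e : α} (hy : y ∈ M.E)
    (he : e ∈ N.E) (p : ℕ) :
    {T : Set α | T ⊆ (M.E ∪ N.E) \ {y, e} ∧ T.ncard = p ∧ Q (T ∩ M.E) ∧ Q' (T ∩ N.E)}.ncard =
      ∑ a ∈ Finset.range (p + 1),
        {T₁ : Set α | T₁ ⊆ M.E \ {y} ∧ T₁.ncard = a ∧ Q T₁}.ncard *
          {T₂ : Set α | T₂ ⊆ N.E \ {e} ∧ T₂.ncard = p - a ∧ Q' T₂}.ncard := by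
  classical
  have heM : e ∉ M.E := fun hmem => Set.disjoint_left.mp h hmem he
  have hyN : y ∉ N.E := fun hmem => Set.disjoint_left.mp h hy hmem
  set 𝒮 : Set (Set α) :=
    {T : Set α | T ⊆ (M.E ∪ N.E) \ {y, e} ∧ T.ncard = p ∧ Q (T ∩ M.E) ∧ Q' (T ∩ N.E)} with h𝒮
  have hEfin : (M.E ∪ N.E).Finite := M.ground_finite.union N.ground_finite
  have h𝒮fin : 𝒮.Finite := hEfin.finite_subsets.subset (fun T hT => hT.1.trans Set.sdiff_subset)
  have hmaps : ∀ T ∈ h𝒮fin.toFinset, (T ∩ M.E).ncard ∈ Finset.range (p + 1) := by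
    intro T hT
    rw [h𝒮fin.mem_toFinset] at hT
    rw [Finset.mem_range, Nat.lt_succ_iff, ← hT.2.1]
    exact Set.ncard_le_ncard Set.inter_subset_left (hEfin.subset (hT.1.trans Set.sdiff_subset))
  rw [Set.ncard_eq_toFinset_card 𝒮 h𝒮fin, Finset.card_eq_sum_card_fiberwise hmaps]
  refine Finset.sum_congr rfl (fun a ha => ?_)
  rw [Finset.mem_range, Nat.lt_succ_iff] at ha
  rw [← Set.ncard_coe_finset, ← Set.ncard_prod]
  refine Set.ncard_congr (fun T _ => (T ∩ M.E, T ∩ N.E)) ?_ ?_ ?_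
  · intro T hT
    obtain ⟨hT1, hTa⟩ := Finset.mem_filter.mp (Finset.mem_coe.mp hT)
    obtain ⟨hTE, hTcard, hQ, hQ'⟩ := h𝒮fin.mem_toFinset.mp hT1
    have hTE' : T ⊆ M.E ∪ N.E := hTE.trans Set.sdiff_subset
    have hsplit := ncard_eq_ncard_inter_add_ncard_inter h hTE' (hEfin.subset hTE')
    refine Set.mem_prod.mpr ⟨⟨?_, hTa, hQ⟩, ⟨?_, ?_, hQ'⟩⟩
    · intro x hx
      exact ⟨hx.2, fun hxy => (hTE hx.1).2 (Set.mem_insert_iff.mpr (Or.inl hxy))⟩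
    · intro x hx
      exact ⟨hx.2, fun hxe => (hTE hx.1).2 (Set.mem_insert_iff.mpr (Or.inr hxe))⟩
    · show (T ∩ N.E).ncard = p - a
      omega
  · intro T T' hT hT' hTT'
    simp only [Prod.mk.injEq] at hTT'
    obtain ⟨hT1, -⟩ := Finset.mem_filter.mp (Finset.mem_coe.mp hT)
    obtain ⟨hT'1, -⟩ := Finset.mem_filter.mp (Finset.mem_coe.mp hT')
    have hTE : T ⊆ M.E ∪ N.E := (h𝒮fin.mem_toFinset.mp hT1).1.trans Set.sdiff_subset
    have hT'E : T' ⊆ M.E ∪ N.E := (h𝒮fin.mem_toFinset.mp hT'1).1.trans Set.sdiff_subset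
    ext x
    constructor
    · intro hx
      rcases hTE hx with hxM | hxN
      · have hx' : x ∈ T' ∩ M.E := hTT'.1 ▸ ⟨hx, hxM⟩
        exact hx'.1
      · have hx' : x ∈ T' ∩ N.E := hTT'.2 ▸ ⟨hx, hxN⟩
        exact hx'.1
    · intro hx
      rcases hT'E hx with hxM | hxN
      · have hx' : x ∈ T ∩ M.E := hTT'.1.symm ▸ ⟨hx, hxM⟩
        exact hx'.1
      · have hx' : x ∈ T ∩ N.E := hTT'.2.symm ▸ ⟨hx, hxN⟩
        exact hx'.1
  · rintro ⟨T₁, T₂⟩ hpair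
    rw [Set.mem_prod] at hpair
    obtain ⟨⟨hT₁E, hT₁card, hQ⟩, hT₂E, hT₂card, hQ'⟩ := hpair
    have hT₁E' : T₁ ⊆ M.E := hT₁E.trans Set.sdiff_subset
    have hT₂E' : T₂ ⊆ N.E := hT₂E.trans Set.sdiff_subset
    have hdisj : Disjoint T₁ T₂ := Set.disjoint_of_subset hT₁E' hT₂E' h
    have e₁ : (T₁ ∪ T₂) ∩ M.E = T₁ := by
      rw [Set.union_inter_distrib_right, Set.inter_eq_self_of_subset_left hT₁E',
        (Set.disjoint_of_subset_left hT₂E' h.symm).inter_eq, Set.union_empty]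
    have e₂ : (T₁ ∪ T₂) ∩ N.E = T₂ := by
      rw [Set.union_inter_distrib_right, Set.inter_eq_self_of_subset_left hT₂E',
        (Set.disjoint_of_subset_left hT₁E' h).inter_eq, Set.empty_union]
    refine ⟨T₁ ∪ T₂, ?_, ?_⟩
    · rw [Finset.mem_coe, Finset.mem_filter, h𝒮fin.mem_toFinset]
      refine ⟨⟨?_, ?_, by rw [e₁]; exact hQ, by rw [e₂]; exact hQ'⟩, by rw [e₁]; exact hT₁card⟩
      · intro x hx
        rcases hx with hx | hx
        · refine ⟨Or.inl (hT₁E hx).1, fun hxd => ?_⟩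
          rcases Set.mem_insert_iff.mp hxd with rfl | hxe
          · exact (hT₁E hx).2 rfl
          · exact heM (Set.mem_singleton_iff.mp hxe ▸ (hT₁E hx).1)
        · refine ⟨Or.inr (hT₂E hx).1, fun hxd => ?_⟩
          rcases Set.mem_insert_iff.mp hxd with rfl | hxe
          · exact hyN (hT₂E hx).1
          · exact (hT₂E hx).2 hxe
      · rw [Set.ncard_union_eq hdisj (M.ground_finite.subset hT₁E') (N.ground_finite.subset hT₂E'), hT₁card,
          hT₂card]
        omega
    · simp only [e₁, e₂]

/-- The two-row kernel of `N` at `e`: row `0` is the deletion profile `y_{p−i}(N; e)`, row `1` the contraction profile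
`x_{p−i}(N; e)` (`0` beyond `p`). -/
noncomputable def sriKer (e : α) (p r i : ℕ) : ℕ :=
  if i ≤ p then (if r = 0 then deleteCount N e (p - i) else contractCount N e (p - i)) else 0

/-- **(CD) makes the two-row kernel TP2**: `K(1,i) · K(0,j) ≤ K(0,i) · K(1,j)` for `i ≤ j`. -/
lemma sriKer_tp2 (hN : IndepCD N) {e : α} (he : e ∈ N.E) (p : ℕ) {i j : ℕ} (hij : i ≤ j) :
    sriKer N e p 1 i * sriKer N e p 0 j ≤ sriKer N e p 0 i * sriKer N e p 1 j := by
  unfold sriKer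
  by_cases hjp : j ≤ p
  · have hip : i ≤ p := hij.trans hjp
    simp only [hip, hjp, if_true, one_ne_zero, if_false]
    have := indepCD_all_pairs N hN he (i := p - j) (j := p - i) (by omega)
    calc contractCount N e (p - i) * deleteCount N e (p - j)
        ≤ contractCount N e (p - j) * deleteCount N e (p - i) := this
      _ = deleteCount N e (p - i) * contractCount N e (p - j) := mul_comm _ _
  · simp only [hjp, if_false, mul_zero]
    exact Nat.zero_le _

variable (h : Disjoint M.E N.E)

/-- A slice of `M ⊕ N` at `y ∈ E_M`, `e ∈ E_N` as a two-trace count: `T ∪ A` independent in the sum iff the `M`-trace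
with `A ∩ {y}` and the `N`-trace with `A ∩ {e}` are independent. -/
lemma sliceCount_disjointSum_eq (Q Q' : Set α → Prop) {y e : α} (hy : y ∈ M.E) (he : e ∈ N.E) (A : Set α)
    (hA : ∀ T : Set α, T ⊆ (M.E ∪ N.E) \ {y, e} →
      ((M.disjointSum N h).Indep (T ∪ A) ↔ Q (T ∩ M.E) ∧ Q' (T ∩ N.E))) (p : ℕ) :
    sliceCount (M.disjointSum N h) y e A p =
      ∑ a ∈ Finset.range (p + 1),
        {T₁ : Set α | T₁ ⊆ M.E \ {y} ∧ T₁.ncard = a ∧ Q T₁}.ncard *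
          {T₂ : Set α | T₂ ⊆ N.E \ {e} ∧ T₂.ncard = p - a ∧ Q' T₂}.ncard := by
  rw [← ncard_trace_disjointSum₂ M N h Q Q' hy he p]
  unfold sliceCount
  congr 1
  ext T
  simp only [Set.mem_setOf_eq, Matroid.disjointSum_ground_eq]
  constructor
  · rintro ⟨hTE, hT, hind⟩
    exact ⟨hTE, hT, (hA T hTE).mp hind⟩
  · rintro ⟨hTE, hT, hQQ'⟩
    exact ⟨hTE, hT, (hA T hTE).mpr hQQ'⟩

/-- The slice `∅`: both traces plainly independent. -/
lemma sliceCount_disjointSum_empty {y e : α} (hy : y ∈ M.E) (he : e ∈ N.E) (p : ℕ) :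
    sliceCount (M.disjointSum N h) y e ∅ p =
      ∑ a ∈ Finset.range (p + 1), deleteCount M y a * deleteCount N e (p - a) := by
  unfold deleteCount
  refine sliceCount_disjointSum_eq M N h (fun T₁ => M.Indep T₁) (fun T₂ => N.Indep T₂) hy he ∅ ?_ p
  intro T hTE
  rw [Set.union_empty, Matroid.disjointSum_indep_iff]
  exact ⟨fun ⟨hM, hN, _⟩ => ⟨hM, hN⟩, fun ⟨hM, hN⟩ => ⟨hM, hN, hTE.trans Set.sdiff_subset⟩⟩

/-- The slice `{y}`: the `M`-trace with `y`, the `N`-trace plain. -/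
lemma sliceCount_disjointSum_left {y e : α} (hy : y ∈ M.E) (he : e ∈ N.E) (p : ℕ) :
    sliceCount (M.disjointSum N h) y e {y} p =
      ∑ a ∈ Finset.range (p + 1), contractCount M y a * deleteCount N e (p - a) := by
  have hyN : y ∉ N.E := fun hmem => Set.disjoint_left.mp h hy hmem
  unfold contractCount deleteCount
  refine sliceCount_disjointSum_eq M N h (fun T₁ => M.Indep (insert y T₁)) (fun T₂ => N.Indep T₂) hy he {y} ?_ p
  intro T hTE
  rw [Set.union_singleton, Matroid.disjointSum_indep_iff, Set.insert_inter_of_mem hy, Set.insert_inter_of_notMem hyN]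
  exact ⟨fun ⟨hM, hN, _⟩ => ⟨hM, hN⟩,
    fun ⟨hM, hN⟩ => ⟨hM, hN, Set.insert_subset (Or.inl hy) (hTE.trans Set.sdiff_subset)⟩⟩

/-- The slice `{e}`: the `M`-trace plain, the `N`-trace with `e`. -/
lemma sliceCount_disjointSum_right {y e : α} (hy : y ∈ M.E) (he : e ∈ N.E) (p : ℕ) :
    sliceCount (M.disjointSum N h) y e {e} p =
      ∑ a ∈ Finset.range (p + 1), deleteCount M y a * contractCount N e (p - a) := by
  have heM : e ∉ M.E := fun hmem => Set.disjoint_left.mp h hmem he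
  unfold contractCount deleteCount
  refine sliceCount_disjointSum_eq M N h (fun T₁ => M.Indep T₁) (fun T₂ => N.Indep (insert e T₂)) hy he {e} ?_ p
  intro T hTE
  rw [Set.union_singleton, Matroid.disjointSum_indep_iff, Set.insert_inter_of_notMem heM, Set.insert_inter_of_mem he]
  exact ⟨fun ⟨hM, hN, _⟩ => ⟨hM, hN⟩,
    fun ⟨hM, hN⟩ => ⟨hM, hN, Set.insert_subset (Or.inr he) (hTE.trans Set.sdiff_subset)⟩⟩

/-- The slice `{y, e}`: both traces with their marked element. -/
lemma sliceCount_disjointSum_both {y e : α} (hy : y ∈ M.E) (he : e ∈ N.E) (p : ℕ) :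
    sliceCount (M.disjointSum N h) y e {y, e} p =
      ∑ a ∈ Finset.range (p + 1), contractCount M y a * contractCount N e (p - a) := by
  have heM : e ∉ M.E := fun hmem => Set.disjoint_left.mp h hmem he
  have hyN : y ∉ N.E := fun hmem => Set.disjoint_left.mp h hy hmem
  unfold contractCount
  refine sliceCount_disjointSum_eq M N h (fun T₁ => M.Indep (insert y T₁)) (fun T₂ => N.Indep (insert e T₂)) hy he
    {y, e} ?_ p
  intro T hTE
  have e1 : T ∪ {y, e} = insert y (insert e T) := by
    ext x; simp only [Set.mem_union, Set.mem_insert_iff, Set.mem_singleton_iff]; tauto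
  rw [e1, Matroid.disjointSum_indep_iff, Set.insert_inter_of_mem hy, Set.insert_inter_of_notMem heM,
    Set.insert_inter_of_notMem hyN, Set.insert_inter_of_mem he]
  exact ⟨fun ⟨hM, hN, _⟩ => ⟨hM, hN⟩,
    fun ⟨hM, hN⟩ => ⟨hM, hN, Set.insert_subset (Or.inl hy)
      (Set.insert_subset (Or.inr he) (hTE.trans Set.sdiff_subset))⟩⟩

/-- The four convolutions through the two-row kernel (sums over `range (p + 1)`). -/
lemma sliceCount_disjointSum_ker {y e : α} (hy : y ∈ M.E) (he : e ∈ N.E) (p : ℕ) :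
    sliceCount (M.disjointSum N h) y e ∅ p = ∑ a ∈ Finset.range (p + 1), deleteCount M y a * sriKer N e p 0 a ∧
    sliceCount (M.disjointSum N h) y e {y} p = ∑ a ∈ Finset.range (p + 1), contractCount M y a * sriKer N e p 0 a ∧
    sliceCount (M.disjointSum N h) y e {e} p = ∑ a ∈ Finset.range (p + 1), deleteCount M y a * sriKer N e p 1 a ∧
    sliceCount (M.disjointSum N h) y e {y, e} p =
      ∑ a ∈ Finset.range (p + 1), contractCount M y a * sriKer N e p 1 a := by
  have hk0 : ∀ a ∈ Finset.range (p + 1), sriKer N e p 0 a = deleteCount N e (p - a) := by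
    intro a ha
    rw [Finset.mem_range] at ha
    simp only [sriKer, show a ≤ p by omega, if_true]
  have hk1 : ∀ a ∈ Finset.range (p + 1), sriKer N e p 1 a = contractCount N e (p - a) := by
    intro a ha
    rw [Finset.mem_range] at ha
    simp only [sriKer, show a ≤ p by omega, if_true, one_ne_zero, if_false]
  refine ⟨?_, ?_, ?_, ?_⟩
  · rw [sliceCount_disjointSum_empty M N h hy he p]
    exact Finset.sum_congr rfl (fun a ha => by rw [hk0 a ha])
  · rw [sliceCount_disjointSum_left M N h hy he p]
    exact Finset.sum_congr rfl (fun a ha => by rw [hk0 a ha])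
  · rw [sliceCount_disjointSum_right M N h hy he p]
    exact Finset.sum_congr rfl (fun a ha => by rw [hk1 a ha])
  · rw [sliceCount_disjointSum_both M N h hy he p]
    exact Finset.sum_congr rfl (fun a ha => by rw [hk1 a ha])

/-- **(CD) OF THE SUMMANDS GIVES THE CROSS (SRI) OF THE DIRECT SUM**: for `y ∈ E_M`, `e ∈ E_N` and every `p`,
`I_p^∅ · I_p^{ye} ≤ I_p^y · I_p^e` in `M ⊕ N`. -/
theorem indepSRI_cross_disjointSum (hM : IndepCD M) (hN : IndepCD N) {y e : α} (hy : y ∈ M.E) (he : e ∈ N.E)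
    (p : ℕ) :
    sliceCount (M.disjointSum N h) y e ∅ p * sliceCount (M.disjointSum N h) y e {y, e} p ≤
      sliceCount (M.disjointSum N h) y e {y} p * sliceCount (M.disjointSum N h) y e {e} p := by
  obtain ⟨h0, h1, h2, h3⟩ := sliceCount_disjointSum_ker M N h hy he p
  rw [h0, h1, h2, h3]
  have := tp2_conv (a := contractCount M y) (b := deleteCount M y) (K := sriKer N e p) (p := 0) (q := 1)
    (fun i j hij => indepCD_all_pairs M hM hy hij) (fun i j hij => sriKer_tp2 N hN he p hij)
    (Finset.range (p + 1))
  -- `this : (Σ x_i K1 i) (Σ y_j K0 j) ≤ (Σ x_i K0 i) (Σ y_j K1 j)`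
  calc (∑ a ∈ Finset.range (p + 1), deleteCount M y a * sriKer N e p 0 a) *
        (∑ a ∈ Finset.range (p + 1), contractCount M y a * sriKer N e p 1 a)
      = (∑ a ∈ Finset.range (p + 1), contractCount M y a * sriKer N e p 1 a) *
        (∑ a ∈ Finset.range (p + 1), deleteCount M y a * sriKer N e p 0 a) := mul_comm _ _
    _ ≤ (∑ a ∈ Finset.range (p + 1), contractCount M y a * sriKer N e p 0 a) *
        (∑ a ∈ Finset.range (p + 1), deleteCount M y a * sriKer N e p 1 a) := this

end PercRepro
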